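import Mathlib
import Summits.CriticalPhenomena.CardyFormulaZ2.Theorems.CardySelfRefinementGradientComparabilityStubLayerContactInset
import Summits.CriticalPhenomena.CardyFormulaZ2.Theorems.CardySelfRefinementGradientComparabilityStubLayerContactCrosscut
import Summits.CriticalPhenomena.CardyFormulaZ2.Theorems.CardySelfRefinementGradientComparabilityStubLayerContactWalk
import Literature.Probability.Percolation.QuadCrossingQuadTopology
import Literature.Probability.Percolation.QuadCrossingContinuityReduction
import HarnessLib

/-!
# Boundary-layer surgery, topology brick (S4): the cell-contact lemma

Helper file of the registered stub `stub_layerLocalModification` (the deterministic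
boundary-layer surgery) of the line `monotone-product-coordinates` (crux
`stmt-CriticalPhenomena-10269`, `…Theses.CardySelfRefinement.GradientComparability`), step (S4):
a lattice edge `e = {u, u'}` drawn in `[Q]` with open segment in `[Q]°`, with **no room** on
either side (neither three-edge detour around the cells beside `e` is drawn inside `[Q]`; the
bridge alternative of `quadCarrier_cell_or_bridge`), at a mesh with `3δ ≤ dist (∂₁Q, ∂₃Q)`, and
**not dead** (no cross-cut `β` as in `quad_bridge_deadFinger` has both ends on `∂₁Q` or both on
`∂₃Q` — by `not_isPivotal_Aloc_of_deadFinger` this holds for an edge pivotal in some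
configuration), has on one side `n` a **contact**: a point `a ∈ ∂₀Q ∪ ∂₂Q` of the cell-boundary
walk `u → u + n → u' + n → u'` reached from `u` along the walk inside `[Q]`
(`quad_noRoom_cellContact`, registered helper).  Proof: for small `ε`, the inset paths of
`exists_squareInsetPath` on the two sides, stopped at their first exits from `[Q]°`, form a
cross-cut (`isSimpleArc_twoPaths_crosscut`) with ends on `∂[Q]` less than `3δ` apart, so one
end is on `∂₀Q ∪ ∂₂Q` (`cellContact_oneEps`); `near_firstExit_not_mem` turns these ends, as
`ε → 0`, into a contact of a cell-boundary walk.  No percolation, no named fact.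
-/

noncomputable section

namespace Summit.CriticalPhenomena.CardyFormulaZ2.Theorems.CardySelfRefinement

open scoped Topology
open Filter Set MeasureTheory
open Literature.Probability.LatticeModels Literature.Probability.Percolation
open Literature.Probability.Percolation.QuadCrossing
open Summit.CriticalPhenomena.CardyFormulaZ2.Theses.CardySelfRefinement
open Literature.Topology.PlaneTopology

/-- A segment whose model is covered by a piece of the limit walk `S 0` lies in any set
containing the pushed-forward image of that piece. -/
theorem segment_subset_of_walk {Φ : ℂ → ℂ} {S : ℝ → ℝ → ℂ} {F : Set ℂ}
    (hΦ : ∀ a b : ℂ, Φ '' segment ℝ a b = segment ℝ (Φ a) (Φ b)) {a b t₀ t : ℝ} {c d : ℂ}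
    (hcd : segment ℝ c d ⊆ S 0 '' Icc a b) (hab : Icc a b ⊆ Icc t₀ t)
    (hsub : (fun s => Φ (S 0 s)) '' Icc t₀ t ⊆ F) : segment ℝ (Φ c) (Φ d) ⊆ F := by
  rw [← hΦ]
  rintro _ ⟨z, hz, rfl⟩
  obtain ⟨s, hs, rfl⟩ := hcd hz
  exact hsub ⟨s, hab hs, rfl⟩

/-- **Contact read off the limit walk** `W = Φ ∘ S 0` (`p → q → q' → p'`, `p = Φ 0`, `q = Φ i`,
`q' = Φ (1 + i)`, `p' = Φ 1`): if `W [0, t] ⊆ F` then `W t` is reached from `p` along the walk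
inside `F` by at most three segments. -/
theorem contact_of_walk {Φ : ℂ → ℂ} {S : ℝ → ℝ → ℂ} {F : Set ℂ}
    (hΦ : ∀ a b : ℂ, Φ '' segment ℝ a b = segment ℝ (Φ a) (Φ b))
    (A : (∀ t ∈ Icc (0 : ℝ) (1 / 3), segment ℝ 0 (S 0 t) ⊆ S 0 '' Icc 0 t ∧
      S 0 t ∈ segment ℝ (0 : ℂ) Complex.I) ∧ S 0 (1 / 3) = Complex.I ∧
      (∀ t ∈ Icc (1 / 3 : ℝ) (2 / 3), segment ℝ Complex.I (S 0 t) ⊆ S 0 '' Icc (1 / 3) t ∧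
      S 0 t ∈ segment ℝ Complex.I (1 + Complex.I)) ∧ S 0 (2 / 3) = 1 + Complex.I ∧
      (∀ t ∈ Icc (2 / 3 : ℝ) 1, segment ℝ (1 + Complex.I) (S 0 t) ⊆ S 0 '' Icc (2 / 3) t ∧
      S 0 t ∈ segment ℝ (1 + Complex.I) 1) ∧ S 0 1 = 1)
    {t : ℝ} (ht : t ∈ Icc (0 : ℝ) 1) (hsub : (fun s => Φ (S 0 s)) '' Icc 0 t ⊆ F) :
    (Φ (S 0 t) ∈ segment ℝ (Φ 0) (Φ Complex.I) ∧ segment ℝ (Φ 0) (Φ (S 0 t)) ⊆ F) ∨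
    (Φ (S 0 t) ∈ segment ℝ (Φ Complex.I) (Φ (1 + Complex.I)) ∧
      segment ℝ (Φ 0) (Φ Complex.I) ∪ segment ℝ (Φ Complex.I) (Φ (S 0 t)) ⊆ F) ∨
    (Φ (S 0 t) ∈ segment ℝ (Φ (1 + Complex.I)) (Φ 1) ∧
      segment ℝ (Φ 0) (Φ Complex.I) ∪ segment ℝ (Φ Complex.I) (Φ (1 + Complex.I)) ∪
        segment ℝ (Φ (1 + Complex.I)) (Φ (S 0 t)) ⊆ F) := by
  obtain ⟨A8, A9, A10, A11, A12, -⟩ := A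
  have hmem : ∀ c d : ℂ, S 0 t ∈ segment ℝ c d → Φ (S 0 t) ∈ segment ℝ (Φ c) (Φ d) :=
    fun c d h => by rw [← hΦ]; exact mem_image_of_mem Φ h
  rcases le_or_gt t (1 / 3) with h1 | h1
  · exact Or.inl ⟨hmem _ _ (A8 t ⟨ht.1, h1⟩).2,
      segment_subset_of_walk hΦ (A8 t ⟨ht.1, h1⟩).1 Subset.rfl hsub⟩
  have hpq : segment ℝ (Φ 0) (Φ Complex.I) ⊆ F := by
    have h := (A8 (1 / 3) ⟨by norm_num, le_rfl⟩).1
    rw [A9] at h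
    exact segment_subset_of_walk hΦ h (Icc_subset_Icc_right h1.le) hsub
  rcases le_or_gt t (2 / 3) with h2 | h2
  · exact Or.inr (Or.inl ⟨hmem _ _ (A10 t ⟨h1.le, h2⟩).2, union_subset hpq
      (segment_subset_of_walk hΦ (A10 t ⟨h1.le, h2⟩).1 (Icc_subset_Icc_left (by norm_num))
        hsub)⟩)
  · have hqq : segment ℝ (Φ Complex.I) (Φ (1 + Complex.I)) ⊆ F := by
      have h := (A10 (2 / 3) ⟨by norm_num, le_rfl⟩).1
      rw [A11] at h
      exact segment_subset_of_walk hΦ h (Icc_subset_Icc (by norm_num) h2.le) hsub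
    exact Or.inr (Or.inr ⟨hmem _ _ (A12 t ⟨h2.le, ht.2⟩).2, union_subset (union_subset hpq hqq)
      (segment_subset_of_walk hΦ (A12 t ⟨h2.le, ht.2⟩).1 (Icc_subset_Icc_left (by norm_num))
        hsub)⟩)

/-- The whole cell-boundary walk `p → q → q' → p'` is covered by `W [0, 1]`. -/
theorem walk_subset_image {Φ : ℂ → ℂ} {S : ℝ → ℝ → ℂ}
    (hΦ : ∀ a b : ℂ, Φ '' segment ℝ a b = segment ℝ (Φ a) (Φ b))
    (A : (∀ t ∈ Icc (0 : ℝ) (1 / 3), segment ℝ 0 (S 0 t) ⊆ S 0 '' Icc 0 t ∧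
      S 0 t ∈ segment ℝ (0 : ℂ) Complex.I) ∧ S 0 (1 / 3) = Complex.I ∧
      (∀ t ∈ Icc (1 / 3 : ℝ) (2 / 3), segment ℝ Complex.I (S 0 t) ⊆ S 0 '' Icc (1 / 3) t ∧
      S 0 t ∈ segment ℝ Complex.I (1 + Complex.I)) ∧ S 0 (2 / 3) = 1 + Complex.I ∧
      (∀ t ∈ Icc (2 / 3 : ℝ) 1, segment ℝ (1 + Complex.I) (S 0 t) ⊆ S 0 '' Icc (2 / 3) t ∧
      S 0 t ∈ segment ℝ (1 + Complex.I) 1) ∧ S 0 1 = 1) :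
    segment ℝ (Φ 0) (Φ Complex.I) ∪ segment ℝ (Φ Complex.I) (Φ (1 + Complex.I)) ∪
      segment ℝ (Φ (1 + Complex.I)) (Φ 1) ⊆ (fun s => Φ (S 0 s)) '' Icc 0 1 := by
  obtain ⟨A8, A9, A10, A11, A12, A13⟩ := A
  have h1 := (A8 (1 / 3) ⟨by norm_num, le_rfl⟩).1
  rw [A9] at h1
  have h2 := (A10 (2 / 3) ⟨by norm_num, le_rfl⟩).1
  rw [A11] at h2
  have h3 := (A12 1 ⟨by norm_num, le_rfl⟩).1
  rw [A13] at h3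
  refine union_subset (union_subset ?_ ?_) ?_
  · exact segment_subset_of_walk hΦ h1 (Icc_subset_Icc_right (by norm_num)) Subset.rfl
  · exact segment_subset_of_walk hΦ h2 (Icc_subset_Icc (by norm_num) (by norm_num)) Subset.rfl
  · exact segment_subset_of_walk hΦ h3 (Icc_subset_Icc_left (by norm_num)) Subset.rfl

/-- **One inset `ε`: a first exit on `∂₀Q ∪ ∂₂Q`.**  In the setting of `quad_noRoom_cellContact`,
with `S` the inset family of `exists_squareInsetPath` and `0 < ε ≤ 1/4`: if both inset paths
`t ↦ p + (p' - p) S ε t`, `t ↦ p + (p' - p) conj (S ε t)` leave `[Q]°`, then one of them has its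
first exit from `[Q]°` on `∂₀Q ∪ ∂₂Q`. -/
theorem cellContact_oneEps {D : Set ℂ} {δ : ℝ} (hδ : 0 < δ) (Q : Quad D) {u u' : Site 2}
    (huu' : (zdGraph 2).Adj u u')
    (hopen : openSegment ℝ (meshPoint δ u) (meshPoint δ u') ⊆ interior Q.carrier)
    (hdist : ∀ z ∈ Q.side 1, ∀ w ∈ Q.side 3, 3 * δ ≤ dist z w)
    (hND : ∀ (β : Set ℂ) (a b m : ℂ) (ρ : ℝ), m ∈ openSegment ℝ (meshPoint δ u) (meshPoint δ u') →
      IsSimpleArc β a b → a ∉ Q.side 0 ∪ Q.side 2 → b ∉ Q.side 0 ∪ Q.side 2 →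
      β \ {a, b} ⊆ interior Q.carrier → β ∩ openEdgeUnion δ Set.univ ⊆ {m} → 0 < ρ →
      Metric.ball m ρ ⊆ interior Q.carrier →
      β ∩ Metric.ball m ρ = Metric.ball m ρ ∩
        {z | inner ℝ (z - m) (meshPoint δ u' - meshPoint δ u) = 0} →
      ¬ (a ∈ Q.side 1 ∧ b ∈ Q.side 1 ∨ a ∈ Q.side 3 ∧ b ∈ Q.side 3))
    {S : ℝ → ℝ → ℂ} (A1 : ∀ ε, Continuous (S ε))
    (A2 : ∀ ε ∈ Ico (0 : ℝ) (1 / 2), InjOn (S ε) (Icc 0 1))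
    (A3 : ∀ ε t : ℝ, t ≤ 1 / 3 → S ε t = (ε : ℂ) + ((3 * t * (1 - ε) : ℝ) : ℂ) * Complex.I)
    (A4 : ∀ ε ∈ Icc (0 : ℝ) (1 / 4), ∀ t ∈ Icc (1 / 3 : ℝ) 1, 1 / 2 ≤ dist (S ε t) (S ε 0))
    (A5 : ∀ ε : ℝ, S ε 1 = ((1 - ε : ℝ) : ℂ))
    (A6 : ∀ ε ∈ Icc (0 : ℝ) (1 / 2), ∀ t ∈ Icc (0 : ℝ) 1, (S ε t).re ∈ Icc ε (1 - ε) ∧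
      (S ε t).im ∈ Icc 0 (1 - ε) ∧ (t ∈ Ioo (0 : ℝ) 1 → 0 < (S ε t).im))
    {ε : ℝ} (hε0 : 0 < ε) (hε1 : ε ≤ 1 / 4)
    (hex₁ : ∃ t ∈ Icc (0 : ℝ) 1,
      meshPoint δ u + (meshPoint δ u' - meshPoint δ u) * S ε t ∉ interior Q.carrier)
    (hex₂ : ∃ t ∈ Icc (0 : ℝ) 1, meshPoint δ u + (meshPoint δ u' - meshPoint δ u) *
      (starRingEnd ℂ) (S ε t) ∉ interior Q.carrier) :
    (∃ τ ∈ Ioo (0 : ℝ) 1, meshPoint δ u + (meshPoint δ u' - meshPoint δ u) * S ε τ ∈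
      Q.side 0 ∪ Q.side 2 ∧ ∀ t ∈ Ico (0 : ℝ) τ,
        meshPoint δ u + (meshPoint δ u' - meshPoint δ u) * S ε t ∈ interior Q.carrier) ∨
    (∃ τ ∈ Ioo (0 : ℝ) 1, meshPoint δ u + (meshPoint δ u' - meshPoint δ u) *
      (starRingEnd ℂ) (S ε τ) ∈ Q.side 0 ∪ Q.side 2 ∧ ∀ t ∈ Ico (0 : ℝ) τ,
        meshPoint δ u + (meshPoint δ u' - meshPoint δ u) * (starRingEnd ℂ) (S ε t) ∈
          interior Q.carrier) := by
  set p : ℂ := meshPoint δ u with hp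
  set p' : ℂ := meshPoint δ u' with hp'
  set v : ℂ := p' - p with hv
  set U : Set ℂ := interior Q.carrier with hU
  set Λ₁ : ℝ → ℂ := fun t => p + v * S ε t with hΛ₁
  set Λ₂ : ℝ → ℂ := fun t => p + v * (starRingEnd ℂ) (S ε t) with hΛ₂
  set m : ℂ := p + (ε : ℂ) * v with hmdef
  have hvn : ‖v‖ = δ := norm_meshPoint_sub_eq_of_adj hδ huu'
  have hv0 : v ≠ 0 := fun h => hδ.ne' (by rw [← hvn, h, norm_zero])
  have hεI : ε ∈ Icc (0 : ℝ) (1 / 2) := ⟨hε0.le, by linarith⟩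
  have hS0 : S ε 0 = (ε : ℂ) := by rw [A3 ε 0 (by norm_num)]; simp
  have hconj : ∀ z : ℂ, (starRingEnd ℂ) z = (z.re : ℂ) + ((-z.im : ℝ) : ℂ) * Complex.I :=
    fun z => Complex.ext (by simp) (by simp)
  have h10 : Λ₁ 0 = m := by simp only [hΛ₁, hS0, hmdef]; ring
  have h20 : Λ₂ 0 = m := by simp only [hΛ₂, hS0, hmdef, Complex.conj_ofReal]; ring
  have hmseg : ∀ θ : ℝ, 0 < θ → θ < 1 → p + (θ : ℂ) * v ∈ openSegment ℝ p p' := fun θ h0 h1 =>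
    ⟨1 - θ, θ, by linarith, h0, by ring, by simp only [hv, Complex.real_smul]; push_cast; ring⟩
  have hmU : m ∈ U := hopen (hmseg ε hε0 (by linarith))
  have hm : m ∈ openSegment ℝ p p' := hmseg ε hε0 (by linarith)
  have h11 : Λ₁ 1 ∈ U := by
    have : Λ₁ 1 = p + ((1 - ε : ℝ) : ℂ) * v := by simp only [hΛ₁, A5]; ring
    rw [this]; exact hopen (hmseg (1 - ε) (by linarith) (by linarith))
  have h21 : Λ₂ 1 ∈ U := by
    have : Λ₂ 1 = p + ((1 - ε : ℝ) : ℂ) * v := by simp only [hΛ₂, A5, Complex.conj_ofReal]; ring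
    rw [this]; exact hopen (hmseg (1 - ε) (by linarith) (by linarith))
  have hc₁ : Continuous Λ₁ := by simp only [hΛ₁]; fun_prop
  have hc₂ : Continuous Λ₂ := by
    simp only [hΛ₂]
    exact continuous_const.add (continuous_const.mul (Complex.continuous_conj.comp (A1 ε)))
  have hinj₁ : InjOn Λ₁ (Icc 0 1) := fun s hs t ht hst =>
    A2 ε ⟨hε0.le, by linarith⟩ hs ht (mul_left_cancel₀ hv0 (add_left_cancel hst))
  have hinj₂ : InjOn Λ₂ (Icc 0 1) := fun s hs t ht hst =>
    A2 ε ⟨hε0.le, by linarith⟩ hs ht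
      ((starRingEnd ℂ).injective (mul_left_cancel₀ hv0 (add_left_cancel hst)))
  obtain ⟨t₁, ht₁, hout₁⟩ := hex₁
  obtain ⟨t₂, ht₂, hout₂⟩ := hex₂
  obtain ⟨τ₁, hτ₁, hτ₁U, hτ₁cl, hbef₁⟩ :=
    exists_firstExit_of_isOpen hc₁.continuousOn isOpen_interior (h10.symm ▸ hmU) ht₁ hout₁
  obtain ⟨τ₂, hτ₂, hτ₂U, hτ₂cl, hbef₂⟩ :=
    exists_firstExit_of_isOpen hc₂.continuousOn isOpen_interior (h20.symm ▸ hmU) ht₂ hout₂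
  have hτ₁1 : τ₁ < 1 := lt_of_le_of_ne (hτ₁.2.trans ht₁.2) fun h => hτ₁U (h ▸ h11)
  have hτ₂1 : τ₂ < 1 := lt_of_le_of_ne (hτ₂.2.trans ht₂.2) fun h => hτ₂U (h ▸ h21)
  have hfr : ∀ z, z ∈ closure U → z ∉ U → z ∉ Q.side 0 ∪ Q.side 2 → z ∈ Q.side 1 ∨ z ∈ Q.side 3 := by
    intro z hzcl hzU hz02
    have hzQ : z ∈ Q.carrier := by rwa [Q.closure_interior_carrier] at hzcl
    have hz : z ∈ frontier Q.carrier := ⟨subset_closure hzQ, hzU⟩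
    rw [Q.frontier_carrier] at hz
    simp only [mem_union, not_or] at hz hz02
    tauto
  by_cases hG₁ : Λ₁ τ₁ ∈ Q.side 0 ∪ Q.side 2
  · exact Or.inl ⟨τ₁, ⟨hτ₁.1, hτ₁1⟩, hG₁, hbef₁⟩
  by_cases hG₂ : Λ₂ τ₂ ∈ Q.side 0 ∪ Q.side 2
  · exact Or.inr ⟨τ₂, ⟨hτ₂.1, hτ₂1⟩, hG₂, hbef₂⟩
  exfalso
  have hstr₁ : ∀ t ∈ Icc (0 : ℝ) (1 / 3), Λ₁ t = m + ((3 * (1 - ε) * t : ℝ) : ℂ) * (Complex.I * v) := by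
    intro t ht; simp only [hΛ₁, A3 ε t ht.2, hmdef]; push_cast; ring
  have hstr₂ : ∀ t ∈ Icc (0 : ℝ) (1 / 3), Λ₂ t = m - ((3 * (1 - ε) * t : ℝ) : ℂ) * (Complex.I * v) := by
    intro t ht
    simp only [hΛ₂, A3 ε t ht.2, hmdef, map_add, map_mul, Complex.conj_ofReal, Complex.conj_I]
    push_cast; ring
  have hfar₁ : ∀ t ∈ Icc (1 / 3 : ℝ) 1, δ / 2 ≤ dist (Λ₁ t) m := by
    intro t ht
    have h := A4 ε ⟨hε0.le, hε1⟩ t ht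
    rw [← h10, dist_eq_norm, show Λ₁ t - Λ₁ 0 = v * (S ε t - S ε 0) by simp only [hΛ₁]; ring,
      norm_mul, hvn, ← dist_eq_norm]
    nlinarith
  have hfar₂ : ∀ t ∈ Icc (1 / 3 : ℝ) 1, δ / 2 ≤ dist (Λ₂ t) m := by
    intro t ht
    have h := A4 ε ⟨hε0.le, hε1⟩ t ht
    rw [← h20, dist_eq_norm, show Λ₂ t - Λ₂ 0 = v * ((starRingEnd ℂ) (S ε t) -
      (starRingEnd ℂ) (S ε 0)) by simp only [hΛ₂]; ring, norm_mul, hvn, ← dist_eq_norm,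
      Complex.dist_conj_conj]
    nlinarith
  have hdisj : Disjoint (Λ₁ '' Ioo 0 1) (Λ₂ '' Ioo 0 1) := by
    rw [Set.disjoint_left]
    rintro _ ⟨s, hs, rfl⟩ ⟨t, ht, hst⟩
    have h : (starRingEnd ℂ) (S ε t) = S ε s :=
      mul_left_cancel₀ hv0 (add_left_cancel hst)
    have h1 := congrArg Complex.im h
    rw [Complex.conj_im] at h1
    have hs' := (A6 ε hεI s ⟨hs.1.le, hs.2.le⟩).2.2 hs
    have ht' := (A6 ε hεI t ⟨ht.1.le, ht.2.le⟩).2.2 ht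
    linarith
  have hX : Disjoint (Λ₁ '' Ioo 0 1 ∪ Λ₂ '' Ioo 0 1) (openEdgeUnion δ Set.univ) := by
    rw [Set.disjoint_left]
    rintro z hz hzX
    have hzg := openEdgeUnion_univ_subset_gridLines δ hzX
    rcases hz with ⟨t, ht, rfl⟩ | ⟨t, ht, rfl⟩ <;>
      obtain ⟨hre, him, hpos⟩ := A6 ε hεI t ⟨ht.1.le, ht.2.le⟩ <;> have hpos' := hpos ht
    · exact edge_frame_not_mem_gridLines hδ huu' (s := (S ε t).re) (r := (S ε t).im)
        ⟨by linarith [hre.1], by linarith [hre.2]⟩ (by linarith [him.1]) (by linarith [him.2])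
        hpos'.ne' (by rwa [Complex.re_add_im])
    · exact edge_frame_not_mem_gridLines hδ huu' (s := (S ε t).re) (r := -(S ε t).im)
        ⟨by linarith [hre.1], by linarith [hre.2]⟩ (by linarith [him.2]) (by linarith [him.1])
        (by linarith) (by rwa [← hconj])
  obtain ⟨harc, hint, hXm, ρ, hρ, hball, hβ⟩ := isSimpleArc_twoPaths_crosscut U
    (openEdgeUnion δ Set.univ) Λ₁ Λ₂ m v (3 * (1 - ε)) (1 / 3) (δ / 2) τ₁ τ₂ isOpen_interior hv0
    (by linarith) (by norm_num) (by positivity) hc₁.continuousOn hc₂.continuousOn hinj₁ hinj₂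
    hstr₁ hstr₂ hfar₁ hfar₂ hdisj hX ⟨hτ₁.1, hτ₁1⟩ ⟨hτ₂.1, hτ₂1⟩ hbef₁ hbef₂
  have key := hND _ (Λ₂ τ₂) (Λ₁ τ₁) m ρ hm harc hG₂ hG₁ hint hXm hρ hball hβ
  -- the labels of the two ends
  have hl₁ := hfr (Λ₁ τ₁) hτ₁cl hτ₁U hG₁
  have hl₂ := hfr (Λ₂ τ₂) hτ₂cl hτ₂U hG₂
  have hd : dist (Λ₁ τ₁) (Λ₂ τ₂) < 3 * δ := by
    obtain ⟨hre₁, him₁, -⟩ := A6 ε hεI τ₁ ⟨hτ₁.1.le, hτ₁1.le⟩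
    obtain ⟨hre₂, him₂, -⟩ := A6 ε hεI τ₂ ⟨hτ₂.1.le, hτ₂1.le⟩
    rw [dist_eq_norm, show Λ₁ τ₁ - Λ₂ τ₂ = v * (S ε τ₁ - (starRingEnd ℂ) (S ε τ₂)) by
      simp only [hΛ₁, hΛ₂]; ring, norm_mul, hvn]
    have h1 : |(S ε τ₁ - (starRingEnd ℂ) (S ε τ₂)).re| ≤ 1 - 2 * ε := by
      rw [Complex.sub_re, Complex.conj_re, abs_le]
      constructor <;> linarith [hre₁.1, hre₁.2, hre₂.1, hre₂.2]
    have h2 : |(S ε τ₁ - (starRingEnd ℂ) (S ε τ₂)).im| ≤ 2 - 2 * ε := by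
      rw [Complex.sub_im, Complex.conj_im, abs_le]
      constructor <;> linarith [him₁.1, him₁.2, him₂.1, him₂.2]
    have h3 := Complex.norm_le_abs_re_add_abs_im (S ε τ₁ - (starRingEnd ℂ) (S ε τ₂))
    nlinarith
  rcases hl₂ with h₂ | h₂ <;> rcases hl₁ with h₁ | h₁
  · exact key (Or.inl ⟨h₂, h₁⟩)
  · have := hdist _ h₂ _ h₁
    rw [dist_comm] at hd
    linarith
  · have := hdist _ h₁ _ h₂
    linarith
  · exact key (Or.inr ⟨h₂, h₁⟩)

/-- **Cell-contact lemma** (brick (S4) of the boundary-layer surgery `stub_layerLocalModification`;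
registered helper).  Let `Q` be a quad and `{u, u'}` a lattice edge whose closed segment drawn at
mesh `δ > 0` lies in `[Q]` and whose open segment lies in `[Q]°`, with `3δ ≤ dist (∂₁Q, ∂₃Q)`.
Assume **no room** — for each unit normal `n` of the edge, the three-edge detour
`u → u + n → u' + n → u'` is not drawn inside `[Q]` (e.g. the edge is a bridge of the lattice
graph drawn in `[Q]`, `quadCarrier_cell_or_bridge`) — and **not dead**: no cross-cut `β` as in
`quad_bridge_deadFinger` (a simple arc through a point `m` of the open segment, otherwise in
`[Q]°`, meeting the drawn lattice only at `m`, near `m` the perpendicular diameter of a ball in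
`[Q]°`, ends off `∂₀Q ∪ ∂₂Q`) has both ends on `∂₁Q` or both on `∂₃Q` (given by
`not_isPivotal_Aloc_of_deadFinger` when the edge is pivotal for the crossing of `Q` in some
configuration).  Then on one side `n` there is a point `a ∈ ∂₀Q ∪ ∂₂Q` of the cell-boundary walk
such that the lattice path `u → u + n → u' + n → u'` truncated at `a` (at most three segments,
the last one partial) is drawn inside `[Q]`. -/
theorem quad_noRoom_cellContact : ∀ (D : Set ℂ) (δ : ℝ), 0 < δ → ∀ (Q : Quad D) (u u' : Site 2), (zdGraph 2).Adj u u' → segment ℝ (meshPoint δ u) (meshPoint δ u') ⊆ Q.carrier → openSegment ℝ (meshPoint δ u) (meshPoint δ u') ⊆ interior Q.carrier → (∀ z ∈ Q.side 1, ∀ w ∈ Q.side 3, 3 * δ ≤ dist z w) → (∀ n : Site 2, (zdGraph 2).Adj u (u + n) → u + n ≠ u' → u - n ≠ u' → ¬ (segment ℝ (meshPoint δ u) (meshPoint δ (u + n)) ∪ segment ℝ (meshPoint δ (u + n)) (meshPoint δ (u' + n)) ∪ segment ℝ (meshPoint δ (u' + n)) (meshPoint δ u') ⊆ Q.carrier))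 → (∀ (β : Set ℂ) (a b m : ℂ) (ρ : ℝ), m ∈ openSegment ℝ (meshPoint δ u) (meshPoint δ u') → Literature.Topology.PlaneTopology.IsSimpleArc β a b → a ∉ Q.side 0 ∪ Q.side 2 → b ∉ Q.side 0 ∪ Q.side 2 → β \ {a, b} ⊆ interior Q.carrier → β ∩ openEdgeUnion δ Set.univ ⊆ {m} → 0 < ρ → Metric.ball m ρ ⊆ interior Q.carrier → β ∩ Metric.ball m ρ = Metric.ball m ρ ∩ {z | inner ℝ (z - m) (meshPoint δ u' - meshPoint δ u) = 0} → ¬ (a ∈ Q.side 1 ∧ b ∈ Q.side 1 ∨ a ∈ Q.side 3 ∧ b ∈ Q.side 3)) → ∃ n : Site 2, (zdGraph 2).Adj u (u + n) ∧ u + n ≠ u' ∧ u - n ≠ u' ∧ ∃ a ∈ Q.side 0 ∪ Q.side 2, (a ∈ segment ℝ (meshPoint δ u) (meshPoint δ (u + n)) ∧ segment ℝ (meshPoint δ u) a ⊆ Q.carrier) ∨ (a ∈ segment ℝ (meshPoint δ (u + n)) (meshPoint δ (u' + n)) ∧ segment ℝ (meshPoint δ u) (meshPoint δ (u + n)) ∪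 segment ℝ (meshPoint δ (u + n)) a ⊆ Q.carrier) ∨ (a ∈ segment ℝ (meshPoint δ (u' + n)) (meshPoint δ u') ∧ segment ℝ (meshPoint δ u) (meshPoint δ (u + n)) ∪ segment ℝ (meshPoint δ (u + n)) (meshPoint δ (u' + n)) ∪ segment ℝ (meshPoint δ (u' + n)) a ⊆ Q.carrier) := by
  intro D δ hδ Q u u' huu' hseg hopen hdist hroom hND
  obtain ⟨S, A1, A2, A3, A4, A5, A6, A7, A⟩ := exists_squareInsetPath
  set p : ℂ := meshPoint δ u with hp
  set p' : ℂ := meshPoint δ u' with hp'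
  set v : ℂ := p' - p with hv
  have hvn : ‖v‖ = δ := norm_meshPoint_sub_eq_of_adj hδ huu'
  have hpQ : p ∈ Q.carrier := hseg (left_mem_segment ℝ p p')
  -- the two sides: `σ = 1` (map `z ↦ p + v z`) and `σ = -1` (map `z ↦ p + v z̄`)
  set Φ₁ : ℂ → ℂ := fun z => p + v * z with hΦ₁
  set Φ₂ : ℂ → ℂ := fun z => p + v * (starRingEnd ℂ) z with hΦ₂
  have hΦ₁seg : ∀ a b : ℂ, Φ₁ '' segment ℝ a b = segment ℝ (Φ₁ a) (Φ₁ b) := by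
    intro a b
    rw [segment_eq_image', segment_eq_image', image_image]
    refine image_congr fun θ _ => ?_
    simp only [hΦ₁, Complex.real_smul]; ring
  have hΦ₂seg : ∀ a b : ℂ, Φ₂ '' segment ℝ a b = segment ℝ (Φ₂ a) (Φ₂ b) := by
    intro a b
    rw [segment_eq_image', segment_eq_image', image_image]
    refine image_congr fun θ _ => ?_
    simp only [hΦ₂, Complex.real_smul, map_add, map_sub, map_mul, Complex.conj_ofReal]; ring
  obtain ⟨hadj₁, hne₁, hne₁', hq₁, hq₁'⟩ := rot_normal (n := ![-(1 * (u' 1 - u 1)), 1 * (u' 0 - u 0)])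
    huu' (σ := 1) (Or.inl rfl) rfl
  obtain ⟨hadj₂, hne₂, hne₂', hq₂, hq₂'⟩ :=
    rot_normal (n := ![-(-1 * (u' 1 - u 1)), -1 * (u' 0 - u 0)]) huu' (σ := -1) (Or.inr rfl) rfl
  have c₁0 : Φ₁ 0 = p := by simp [hΦ₁]
  have c₁1 : Φ₁ 1 = p' := by simp only [hΦ₁, hv]; ring
  have c₁I : Φ₁ Complex.I = meshPoint δ (u + ![-(1 * (u' 1 - u 1)), 1 * (u' 0 - u 0)]) := by
    rw [hq₁ δ]; simp only [hΦ₁, hv, hp, hp']; push_cast; ring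
  have c₁I' : Φ₁ (1 + Complex.I) =
      meshPoint δ (u' + ![-(1 * (u' 1 - u 1)), 1 * (u' 0 - u 0)]) := by
    rw [hq₁' δ]; simp only [hΦ₁, hv, hp, hp']; push_cast; ring
  have c₂0 : Φ₂ 0 = p := by simp [hΦ₂]
  have c₂1 : Φ₂ 1 = p' := by simp only [hΦ₂, hv, map_one]; ring
  have c₂I : Φ₂ Complex.I = meshPoint δ (u + ![-(-1 * (u' 1 - u 1)), -1 * (u' 0 - u 0)]) := by
    rw [hq₂ δ]; simp only [hΦ₂, hv, hp, hp', Complex.conj_I]; push_cast; ring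
  have c₂I' : Φ₂ (1 + Complex.I) =
      meshPoint δ (u' + ![-(-1 * (u' 1 - u 1)), -1 * (u' 0 - u 0)]) := by
    rw [hq₂' δ]; simp only [hΦ₂, hv, hp, hp', map_add, map_one, Complex.conj_I]; push_cast; ring
  have hW₁c : Continuous fun s => Φ₁ (S 0 s) := by simp only [hΦ₁]; fun_prop
  have hW₂c : Continuous fun s => Φ₂ (S 0 s) := by
    simp only [hΦ₂]
    exact continuous_const.add (continuous_const.mul (Complex.continuous_conj.comp (A1 0)))
  have hW0 : ∀ Φ : ℂ → ℂ, Φ 0 = p → (fun s => Φ (S 0 s)) 0 ∈ Q.carrier := fun Φ h => by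
    have : S 0 0 = 0 := by rw [A3 0 0 (by norm_num)]; simp
    simp only [this, h]; exact hpQ
  by_contra hcon
  -- neither walk has a contact; both walks leave `[Q]` (no room)
  have hwalk : ∀ (Φ : ℂ → ℂ) (n : Site 2), (zdGraph 2).Adj u (u + n) → u + n ≠ u' →
      u - n ≠ u' → (∀ a b : ℂ, Φ '' segment ℝ a b = segment ℝ (Φ a) (Φ b)) → Φ 0 = p →
      Φ 1 = p' → Φ Complex.I = meshPoint δ (u + n) → Φ (1 + Complex.I) = meshPoint δ (u' + n) →
      (∀ t ∈ Icc (0 : ℝ) 1, (fun s => Φ (S 0 s)) '' Icc 0 t ⊆ Q.carrier →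
        (fun s => Φ (S 0 s)) t ∉ Q.side 0 ∪ Q.side 2) ∧
      ∃ t ∈ Icc (0 : ℝ) 1, (fun s => Φ (S 0 s)) t ∉ Q.carrier := by
    intro Φ n hadj hne hne' hΦ h0 h1 hI hI'
    refine ⟨fun t ht hsub hG => ?_, ?_⟩
    · have key := contact_of_walk hΦ A ht hsub
      rw [h0, h1, hI, hI'] at key
      exact hcon ⟨n, hadj, hne, hne', Φ (S 0 t), hG, key⟩
    · by_contra hall
      push Not at hall
      refine hroom n hadj hne hne' ?_
      have key := walk_subset_image hΦ A
      rw [h0, h1, hI, hI'] at key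
      exact key.trans (by rintro _ ⟨s, hs, rfl⟩; exact hall s hs)
  obtain ⟨hno₁, s₁, hs₁, hs₁Q⟩ := hwalk Φ₁ _ hadj₁ hne₁ hne₁' hΦ₁seg c₁0 c₁1 c₁I c₁I'
  obtain ⟨hno₂, s₂, hs₂, hs₂Q⟩ := hwalk Φ₂ _ hadj₂ hne₂ hne₂' hΦ₂seg c₂0 c₂1 c₂I c₂I'
  have hG : IsClosed (Q.side 0 ∪ Q.side 2) := (Q.isCompact_side 0).isClosed.union
    (Q.isCompact_side 2).isClosed
  obtain ⟨ε₁, hε₁, hnear₁⟩ := near_firstExit_not_mem _ Q.carrier (Q.side 0 ∪ Q.side 2) hW₁c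
    Q.isCompact_carrier.isClosed hG (hW0 Φ₁ c₁0) ⟨s₁, hs₁, hs₁Q⟩ hno₁
  obtain ⟨ε₂, hε₂, hnear₂⟩ := near_firstExit_not_mem _ Q.carrier (Q.side 0 ∪ Q.side 2) hW₂c
    Q.isCompact_carrier.isClosed hG (hW0 Φ₂ c₂0) ⟨s₂, hs₂, hs₂Q⟩ hno₂
  obtain ⟨r₁, hr₁, hb₁⟩ := Metric.isOpen_iff.1 Q.isCompact_carrier.isClosed.isOpen_compl _ hs₁Q
  obtain ⟨r₂, hr₂, hb₂⟩ := Metric.isOpen_iff.1 Q.isCompact_carrier.isClosed.isOpen_compl _ hs₂Q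
  set μ : ℝ := min (min ε₁ ε₂) (min r₁ r₂) with hμ
  have hμpos : 0 < μ := lt_min (lt_min hε₁ hε₂) (lt_min hr₁ hr₂)
  set ε : ℝ := min (1 / 4) (μ / (4 * δ)) with hεdef
  have hε0 : 0 < ε := lt_min (by norm_num) (by positivity)
  have hε4 : ε ≤ 1 / 4 := min_le_left _ _
  have hεμ : 2 * ε * δ < μ := by
    have h2 : ε * (4 * δ) ≤ μ := (le_div_iff₀ (by positivity)).1 (min_le_right _ _)
    nlinarith
  have hεI : ε ∈ Icc (0 : ℝ) (1 / 2) := ⟨hε0.le, by linarith⟩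
  -- uniform closeness of the inset paths to the limit walks
  have hclose₁ : ∀ t ∈ Icc (0 : ℝ) 1, dist (Φ₁ (S ε t)) (Φ₁ (S 0 t)) < μ := by
    intro t ht
    rw [dist_eq_norm, show Φ₁ (S ε t) - Φ₁ (S 0 t) = v * (S ε t - S 0 t) by
      simp only [hΦ₁]; ring, norm_mul, hvn, ← dist_eq_norm]
    nlinarith [A7 ε hεI t ht, dist_nonneg (x := S ε t) (y := S 0 t)]
  have hclose₂ : ∀ t ∈ Icc (0 : ℝ) 1, dist (Φ₂ (S ε t)) (Φ₂ (S 0 t)) < μ := by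
    intro t ht
    rw [dist_eq_norm, show Φ₂ (S ε t) - Φ₂ (S 0 t) = v * ((starRingEnd ℂ) (S ε t) -
      (starRingEnd ℂ) (S 0 t)) by simp only [hΦ₂]; ring, norm_mul, hvn, ← dist_eq_norm,
      Complex.dist_conj_conj]
    nlinarith [A7 ε hεI t ht, dist_nonneg (x := S ε t) (y := S 0 t)]
  have hex₁ : ∃ t ∈ Icc (0 : ℝ) 1, Φ₁ (S ε t) ∉ interior Q.carrier :=
    ⟨s₁, hs₁, fun h => hb₁ ((hclose₁ s₁ hs₁).trans_le ((min_le_right _ _).trans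
      (min_le_left _ _))) (interior_subset h)⟩
  have hex₂ : ∃ t ∈ Icc (0 : ℝ) 1, Φ₂ (S ε t) ∉ interior Q.carrier :=
    ⟨s₂, hs₂, fun h => hb₂ ((hclose₂ s₂ hs₂).trans_le ((min_le_right _ _).trans
      (min_le_right _ _))) (interior_subset h)⟩
  rcases cellContact_oneEps hδ Q huu' hopen hdist hND A1 A2 A3 A4 A5 A6 hε0 hε4 hex₁ hex₂
    with ⟨τ, hτ, hτG, hbef⟩ | ⟨τ, hτ, hτG, hbef⟩
  · refine hnear₁ (fun t => Φ₁ (S ε t)) τ (fun t ht => (hclose₁ t ht).trans_le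
      ((min_le_left _ _).trans (min_le_left _ _))) ⟨hτ.1.le, hτ.2.le⟩ (fun t ht => ?_) hτG
    exact interior_subset (hbef t ht)
  · refine hnear₂ (fun t => Φ₂ (S ε t)) τ (fun t ht => (hclose₂ t ht).trans_le
      ((min_le_left _ _).trans (min_le_right _ _))) ⟨hτ.1.le, hτ.2.le⟩ (fun t ht => ?_) hτG
    exact interior_subset (hbef t ht)

end Summit.CriticalPhenomena.CardyFormulaZ2.Theorems.CardySelfRefinement

end
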